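import Literature.MathematicalPhysics.StatisticalMechanics.HardSphereContactTheoremProofs

/-!
# Identification of the limit density of the dilute canonical hard-sphere gas with an LDA activity

Helper file for item `LocalGibbsConcentrationDilute` (stmt-AtomisticToContinuum-13460) of route
`JaynesSqueeze`; part of the unconditional identification of the local-density approximation
(independent of the free-energy files). For a continuous positive activity of the form
`a = ρ R(σ ρ^{1/3})` (`R` the limit insertion ratio of the uniform gas — by Widom's identity,
`…DiluteFreeEnergy2`, this is the route's activity `ρ e^{g_σ(ρ)}`) with `∫ ρ = 1`, the limit
one-particle density `rhoLim` of
`HardSphereEulerLLN` for the profile `β = a/∫a` IS `ρ` (`rhoLim_profileOf_eq`):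

* the uniform ratio equation at the sub-density `σ ρ(x)^{1/3}` reads `∑ γ_j(σ) a(x)^{j+1} = ρ(x)`
  (`tsum_clusterCoeff_mul_pow_activity`);
* hence `R* = ∫ a` solves the ratio equation `R F_β(R) = 1` of the profile (interchange of sum and
  integral, `integral_tsum_clusterCoeff`), and `R* ∈ [1/2, 2]`;
* the root is unique (`abs_sub_le_four_mul_gen`, strict monotonicity of `R ↦ R F_β(R)` on
  `[1/2, 2]` for a general profile at small density), so `ratioLimit β σ = ∫ a` and
  `rhoLim β σ = ∑ γ_j (∫a · β)^{j+1} = ∑ γ_j a^{j+1} = ρ`.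

No definitions (pure-proof helper file). prover-pitem-stmt-AtomisticToContinuum-13460-0.
-/

noncomputable section

namespace Summit.AtomisticToContinuum.HydrodynamicLimit.Theorems

open MeasureTheory Filter Topology Set Finset
open Literature.Analysis.FluidPDE Literature.MathematicalPhysics.KineticTheory
open Literature.MathematicalPhysics.StatisticalMechanics Literature.Probability.LatticeModels
open scoped ENNReal

namespace LocalGibbsConcentration

section Series

variable {σ : ℝ} (hσ : 0 < σ) (hσ2 : σ < 1 / 2)
include hσ hσ2

/-- Termwise bound `|γ_j b^{j+1}| ≤ B e (e v₁ σ³ B)ʲ` for `0 ≤ b ≤ B`. [folklore] -/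
theorem abs_clusterCoeff_mul_pow_le {b B : ℝ} (hb0 : 0 ≤ b) (hbB : b ≤ B) (j : ℕ) :
    |clusterCoeff σ j * b ^ (j + 1)| ≤ B * Real.exp 1 * (Real.exp 1 * v₁ * σ ^ 3 * B) ^ j := by
  have hγ := abs_clusterCoeff_le hσ hσ2 j
  have hv := v₁_pos
  have hB : 0 ≤ B := hb0.trans hbB
  rw [abs_mul, abs_of_nonneg (pow_nonneg hb0 _)]
  calc |clusterCoeff σ j| * b ^ (j + 1) ≤ (Real.exp 1 * (Real.exp 1 * (v₁ * σ ^ 3)) ^ j) * B ^ (j + 1) := by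
        gcongr
    _ = B * Real.exp 1 * (Real.exp 1 * v₁ * σ ^ 3 * B) ^ j := by rw [pow_succ, mul_pow, mul_pow]; ring

/-- **Interchange of the cluster series and the integral** for a continuous `0 ≤ b ≤ B` with
`e v₁ σ³ B ≤ 1/4`: `∫ ∑_j γ_j b^{j+1} = ∑_j γ_j ∫ b^{j+1}`, and the pointwise series are summable.
[folklore] -/
theorem integral_tsum_clusterCoeff {b : T3 → ℝ} (hb : Continuous b) {B : ℝ} (hb0 : ∀ y, 0 ≤ b y)
    (hbB : ∀ y, b y ≤ B) (hBσ : Real.exp 1 * v₁ * σ ^ 3 * B ≤ 1 / 4) :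
    (∫ y, ∑' j, clusterCoeff σ j * b y ^ (j + 1)) = ∑' j, clusterCoeff σ j * ∫ y, b y ^ (j + 1) := by
  have hB : 0 ≤ B := (hb0 0).trans (hbB 0)
  have hq0 : 0 ≤ Real.exp 1 * v₁ * σ ^ 3 * B := by have := v₁_pos; positivity
  have hq1 : Real.exp 1 * v₁ * σ ^ 3 * B < 1 := by linarith
  set F : ℕ → T3 → ℝ := fun j y => clusterCoeff σ j * b y ^ (j + 1) with hF
  have hFint : ∀ j, Integrable (F j) := fun j => integrable_of_continuous_T3 (continuous_const.mul (hb.pow _))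
  have hsum : Summable fun j => ∫ y, ‖F j y‖ := by
    refine Summable.of_nonneg_of_le (fun j => integral_nonneg fun y => norm_nonneg _) (fun j => ?_)
      ((summable_geometric_of_lt_one hq0 hq1).mul_left (B * Real.exp 1))
    calc ∫ y, ‖F j y‖ ≤ ∫ _ : T3, B * Real.exp 1 * (Real.exp 1 * v₁ * σ ^ 3 * B) ^ j :=
          integral_mono (hFint j).norm (integrable_const _) fun y =>
            (Real.norm_eq_abs _).trans_le (abs_clusterCoeff_mul_pow_le hσ hσ2 (hb0 y) (hbB y) j)
      _ = B * Real.exp 1 * (Real.exp 1 * v₁ * σ ^ 3 * B) ^ j := by simp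
  have h1 : (∫ y, ∑' j, F j y) = ∑' j, ∫ y, F j y :=
    (integral_tsum_of_summable_integral_norm hFint hsum).symm
  calc (∫ y, ∑' j, clusterCoeff σ j * b y ^ (j + 1)) = ∫ y, ∑' j, F j y := rfl
    _ = ∑' j, ∫ y, F j y := h1
    _ = ∑' j, clusterCoeff σ j * ∫ y, b y ^ (j + 1) := by
        refine tsum_congr fun j => ?_
        rw [hF]; dsimp only
        rw [integral_const_mul]

/-- The pointwise cluster series is summable for `0 ≤ b ≤ B`, `e v₁ σ³ B ≤ 1/4`. [folklore] -/
theorem summable_clusterCoeff_mul_pow {b B : ℝ} (hb0 : 0 ≤ b) (hbB : b ≤ B)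
    (hBσ : Real.exp 1 * v₁ * σ ^ 3 * B ≤ 1 / 4) :
    Summable fun j => clusterCoeff σ j * b ^ (j + 1) := by
  have hq0 : 0 ≤ Real.exp 1 * v₁ * σ ^ 3 * B := by have := v₁_pos; have := hb0.trans hbB; positivity
  exact Summable.of_norm_bounded
    ((summable_geometric_of_lt_one hq0 (by linarith)).mul_left (B * Real.exp 1))
    fun j => (Real.norm_eq_abs _).trans_le (abs_clusterCoeff_mul_pow_le hσ hσ2 hb0 hbB j)

end Series

section UniformEquation

/-- **The uniform ratio equation at a sub-density, in the activity form**: for `r > 0` with the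
smallness conditions at `s = (r σ³)^{1/3}` (i.e. `σ r^{1/3}`),
`∑_j γ_j(σ) (r R(s))^{j+1} = r` — the density of the homogeneous gas at activity `r R(s)` is `r`.
[folklore] -/
theorem tsum_clusterCoeff_mul_pow_activity {σ r : ℝ} (hσ : 0 < σ) (hr : 0 < r)
    (h : SmallDensity uniformProfile ((r * σ ^ 3) ^ (1 / 3 : ℝ))) :
    (∑' j, clusterCoeff σ j * (r * ratioLimit uniformProfile ((r * σ ^ 3) ^ (1 / 3 : ℝ))) ^ (j + 1)) = r := by
  set s : ℝ := (r * σ ^ 3) ^ (1 / 3 : ℝ) with hs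
  set R : ℝ := ratioLimit uniformProfile s with hR
  have hs3 : s ^ 3 = r * σ ^ 3 := rpow_third_pow_three (by positivity)
  have hspec := ratioLimit_spec (P := uniformProfile) h.σ_pos h.σ_lt_half h.geomRatio_lt_one h.phi_lt_half
  -- the coefficients at `s` are `rʲ γ_j(σ)`
  have hcoef : ∀ j, clusterCoeff s j = r ^ j * clusterCoeff σ j := fun j => by
    rw [clusterCoeff, clusterCoeff, hs3, mul_pow]; ring
  -- the ratio equation `R ∑ γ_j(s) Rʲ = 1`
  have heq : R * ∑' j, clusterCoeff s j * R ^ j = 1 := by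
    have := hspec.2
    rw [ratioSeries] at this
    simp only [coefLim_uniform] at this
    exact this
  have hsumm : Summable fun j => clusterCoeff s j * R ^ j := by
    have := summable_ratioSeries (P := uniformProfile) h.σ_pos h.σ_lt_half h.geomRatio_lt_one
      (R := R) h.abs_ratioLimit_le
    simp only [coefLim_uniform] at this
    exact this
  calc (∑' j, clusterCoeff σ j * (r * R) ^ (j + 1))
      = ∑' j, r * R * (clusterCoeff s j * R ^ j) := by
        refine tsum_congr fun j => ?_
        rw [hcoef j, mul_pow, pow_succ, pow_succ]; ring
    _ = r * R * ∑' j, clusterCoeff s j * R ^ j := tsum_mul_left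
    _ = r * (R * ∑' j, clusterCoeff s j * R ^ j) := by ring
    _ = r := by rw [heq, mul_one]

end UniformEquation

section Uniqueness

variable {P : DensityProfile} {σ : ℝ} (h : SmallDensity P σ)
include h

/-- Termwise Lipschitz bound in `R` for a general profile:
`|c_j R₂ʲ − c_j R₁ʲ| ≤ (e/2)|R₂ − R₁| · j θʲ` on `[0, 2]`, `c_j = coefLim β σ 1 j`. [folklore] -/
theorem abs_coefLim_mul_pow_sub_le {R₁ R₂ : ℝ} (h1 : R₁ ∈ Icc (0 : ℝ) 2) (h2 : R₂ ∈ Icc (0 : ℝ) 2)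
    (j : ℕ) :
    ‖coefLim P σ (fun _ => 1) j * R₂ ^ j - coefLim P σ (fun _ => 1) j * R₁ ^ j‖ ≤
      Real.exp 1 / 2 * |R₂ - R₁| * (j * geomRatio P σ ^ j) := by
  rw [← mul_sub, Real.norm_eq_abs, abs_mul]
  have hc := abs_coefLim_le (P := P) h.σ_pos h.σ_lt_half (g := fun _ => (1 : ℝ)) measurable_const
    (C := 1) (fun _ => by simp) j
  rw [one_mul] at hc
  have hp := abs_pow_sub_pow_le_of_le h2.1 h2.2 h1.1 h1.2 j
  have hl0 := h.ovDensity_nonneg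
  calc |coefLim P σ (fun _ => 1) j| * |R₂ ^ j - R₁ ^ j|
      ≤ (Real.exp 1 * (Real.exp 1 * ovDensity P σ) ^ j) * (j * 2 ^ (j - 1) * |R₂ - R₁|) :=
        mul_le_mul hc hp (abs_nonneg _) (by positivity)
    _ = Real.exp 1 / 2 * |R₂ - R₁| * (j * geomRatio P σ ^ j) := by
        rw [geomRatio]
        cases j with
        | zero => simp
        | succ j =>
          simp only [Nat.add_sub_cancel]
          rw [mul_pow (2 * Real.exp 1), mul_pow 2 (Real.exp 1), mul_pow (Real.exp 1) (ovDensity P σ),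
            pow_succ (2 : ℝ) j]
          ring

/-- **Lipschitz continuity of `F_β(R)` in `R ∈ [0, 2]`** with constant `κ/2` (general profile).
[folklore] -/
theorem abs_ratioSeries_sub_le_gen {R₁ R₂ : ℝ} (h1 : R₁ ∈ Icc (0 : ℝ) 2) (h2 : R₂ ∈ Icc (0 : ℝ) 2) :
    |ratioSeries P σ R₂ - ratioSeries P σ R₁| ≤ contractionC P σ / 2 * |R₂ - R₁| := by
  have hσ := h.σ_pos
  have hσ2 := h.σ_lt_half
  have hθ0 : 0 ≤ geomRatio P σ := h.geomRatio_nonneg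
  have hθ1 := h.geomRatio_lt_one
  have hs1 := summable_ratioSeries (P := P) hσ hσ2 hθ1 (R := R₁) (abs_le.2 ⟨by linarith [h1.1], h1.2⟩)
  have hs2 := summable_ratioSeries (P := P) hσ hσ2 hθ1 (R := R₂) (abs_le.2 ⟨by linarith [h2.1], h2.2⟩)
  rw [ratioSeries, ratioSeries, ← hs2.tsum_sub hs1]
  have hnorm : ‖geomRatio P σ‖ < 1 := by rwa [Real.norm_eq_abs, abs_of_nonneg hθ0]
  have hmaj := (hasSum_coe_mul_geometric_of_norm_lt_one (𝕜 := ℝ) hnorm).mul_left (Real.exp 1 / 2 * |R₂ - R₁|)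
  have := tsum_of_norm_bounded hmaj (abs_coefLim_mul_pow_sub_le h h1 h2)
  rw [Real.norm_eq_abs] at this
  refine this.trans (le_of_eq ?_)
  rw [contractionC]; ring

/-- **Strict monotonicity of `R ↦ R F_β(R)` on `[1/2, 2]`** (general profile):
`|R₂ − R₁| ≤ 4 |R₂ F(R₂) − R₁ F(R₁)|`. [folklore] -/
theorem abs_sub_le_four_mul_gen {R₁ R₂ : ℝ} (h1 : R₁ ∈ Icc (1 / 2 : ℝ) 2) (h2 : R₂ ∈ Icc (1 / 2 : ℝ) 2) :
    |R₂ - R₁| ≤ 4 * |R₂ * ratioSeries P σ R₂ - R₁ * ratioSeries P σ R₁| := by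
  have hσ := h.σ_pos
  have hσ2 := h.σ_lt_half
  have hθ1 := h.geomRatio_lt_one
  have hκ := h.four_contractionC_lt_one
  have hκ0 : 0 ≤ contractionC P σ := h.contractionC_nonneg
  have hφ := h.phi_lt_half
  have hF : ∀ R ∈ Icc (1 / 2 : ℝ) 2, 1 / 2 ≤ ratioSeries P σ R := by
    intro R hR
    have := abs_ratioSeries_sub_one_le (P := P) hσ hσ2 hθ1 (R := R)
      (abs_le.2 ⟨by linarith [hR.1], hR.2⟩)
    rw [abs_le] at this
    linarith [this.1]
  wlog hle : R₁ ≤ R₂ generalizing R₁ R₂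
  · have := this h2 h1 (le_of_not_ge hle)
    rwa [abs_sub_comm, abs_sub_comm (R₁ * _)] at this
  have hL := abs_ratioSeries_sub_le_gen h ⟨by linarith [h1.1], h1.2⟩ ⟨by linarith [h2.1], h2.2⟩
  rw [abs_of_nonneg (sub_nonneg.2 hle)] at hL ⊢
  rw [abs_le] at hL
  have hF2 := hF R₂ h2
  have hR1 : (0 : ℝ) ≤ R₁ := by linarith [h1.1]
  have key : R₂ * ratioSeries P σ R₂ - R₁ * ratioSeries P σ R₁ =
      (R₂ - R₁) * ratioSeries P σ R₂ + R₁ * (ratioSeries P σ R₂ - ratioSeries P σ R₁) := by ring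
  have t1 : (R₂ - R₁) * (1 / 2) ≤ (R₂ - R₁) * ratioSeries P σ R₂ :=
    mul_le_mul_of_nonneg_left hF2 (sub_nonneg.2 hle)
  have t2 : -(R₁ * (contractionC P σ / 2 * (R₂ - R₁))) ≤
      R₁ * (ratioSeries P σ R₂ - ratioSeries P σ R₁) := by
    have := mul_le_mul_of_nonneg_left hL.1 hR1
    linarith
  have t3 : R₁ * (contractionC P σ / 2 * (R₂ - R₁)) ≤ (R₂ - R₁) / 4 := by
    have hc8 : contractionC P σ / 2 ≤ 1 / 8 := by linarith
    calc R₁ * (contractionC P σ / 2 * (R₂ - R₁)) ≤ 2 * (1 / 8 * (R₂ - R₁)) :=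
          mul_le_mul h1.2 (mul_le_mul_of_nonneg_right hc8 (sub_nonneg.2 hle)) (by positivity) (by norm_num)
      _ = (R₂ - R₁) / 4 := by ring
  have hlow : (R₂ - R₁) / 4 ≤ R₂ * ratioSeries P σ R₂ - R₁ * ratioSeries P σ R₁ := by
    rw [key]; linarith
  rw [abs_of_nonneg (by linarith [div_nonneg (sub_nonneg.2 hle) (by norm_num : (0:ℝ) ≤ 4)])]
  linarith

/-- **Uniqueness of the limit ratio**: a root `R* ∈ [1/2, 2]` of `R F_β(R) = 1` is `ratioLimit β σ`.
[folklore] -/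
theorem ratioLimit_eq_of_root {R : ℝ} (hR : R ∈ Icc (1 / 2 : ℝ) 2) (hroot : R * ratioSeries P σ R = 1) :
    ratioLimit P σ = R := by
  have hspec := ratioLimit_spec (P := P) h.σ_pos h.σ_lt_half h.geomRatio_lt_one h.phi_lt_half
  have h4 := abs_sub_le_four_mul_gen h hR hspec.1
  rw [hspec.2, hroot, sub_self, abs_zero, mul_zero] at h4
  have : |ratioLimit P σ - R| = 0 := le_antisymm h4 (abs_nonneg _)
  rwa [abs_eq_zero, sub_eq_zero] at this

end Uniqueness

section Identification

/-- **The limit density of an LDA activity is the density.** Let `a = ρ · R((ρσ³)^{1/3})`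
pointwise (`R` the limit insertion ratio of the uniform gas, smallness conditions at every
`(ρ(x)σ³)^{1/3}`), with `ρ > 0` continuous, `∫ ρ = 1`, `a ≤ A` and `e v₁ σ³ A ≤ 1/4`, and let the
profile `β = a/∫a` satisfy the smallness conditions at `σ`. Then `rhoLim β σ = ρ`: the uniform
ratio equations give `∑ γ_j a^{j+1} = ρ`, so `∫ a` is a root in `[1/2, 2]` of the profile's ratio
equation, hence equals `ratioLimit β σ` (uniqueness), and the series for `rhoLim` collapses.
[folklore] -/
theorem rhoLim_profileOf_eq {σ : ℝ} (hσ : 0 < σ) (hσ2 : σ < 1 / 2) {a ρ : T3 → ℝ}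
    (ha : Continuous a) (ha0 : ∀ x, 0 < a x) (h : SmallDensity (profileOf a ha ha0) σ)
    (hρpos : ∀ x, 0 < ρ x) (hρ1 : ∫ x, ρ x = 1)
    (hsm : ∀ x, SmallDensity uniformProfile ((ρ x * σ ^ 3) ^ (1 / 3 : ℝ)))
    (hact : ∀ x, a x = ρ x * ratioLimit uniformProfile ((ρ x * σ ^ 3) ^ (1 / 3 : ℝ)))
    {A : ℝ} (hA : ∀ x, a x ≤ A) (hAσ : Real.exp 1 * v₁ * σ ^ 3 * A ≤ 1 / 4) (x : T3) :
    rhoLim (profileOf a ha ha0) σ x = ρ x := by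
  set P := profileOf a ha ha0 with hP
  set Rs : ℝ := ∫ y, a y with hRs
  have hRs_pos : 0 < Rs := integral_pos_of_continuous_pos ha ha0
  have ha0' : ∀ y, 0 ≤ a y := fun y => (ha0 y).le
  -- the pointwise identity `∑ γ_j a^{j+1} = ρ`
  have hpt : ∀ y, (∑' j, clusterCoeff σ j * a y ^ (j + 1)) = ρ y := fun y => by
    rw [hact y]; exact tsum_clusterCoeff_mul_pow_activity hσ (hρpos y) (hsm y)
  -- `∫ a ∈ [1/2, 2]`
  have hρc : Continuous ρ := by
    -- `ρ = ∑ γ_j a^{j+1}` is a uniformly convergent series of continuous functions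
    have hq0 : 0 ≤ Real.exp 1 * v₁ * σ ^ 3 * A := by
      have := v₁_pos; have := (ha0' x).trans (hA x); positivity
    have hcont : Continuous fun y => ∑' j, clusterCoeff σ j * a y ^ (j + 1) :=
      continuous_tsum (fun j => continuous_const.mul (ha.pow _))
        ((summable_geometric_of_lt_one hq0 (by linarith)).mul_left (A * Real.exp 1))
        fun j y => (Real.norm_eq_abs _).trans_le (abs_clusterCoeff_mul_pow_le hσ hσ2 (ha0' y) (hA y) j)
    exact hcont.congr hpt
  have hRx : ∀ y, ratioLimit uniformProfile ((ρ y * σ ^ 3) ^ (1 / 3 : ℝ)) ∈ Icc (1 / 2 : ℝ) 2 :=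
    fun y => (hsm y).ratioLimit_mem
  have hRs_mem : Rs ∈ Icc (1 / 2 : ℝ) 2 := by
    have hint_ρ := integrable_of_continuous_T3 hρc
    have hint_a := integrable_of_continuous_T3 ha
    constructor
    · calc (1 / 2 : ℝ) = ∫ y, ρ y * (1 / 2) := by rw [integral_mul_const, hρ1, one_mul]
        _ ≤ ∫ y, a y := integral_mono (hint_ρ.mul_const _) hint_a fun y => by
            rw [hact y]; exact mul_le_mul_of_nonneg_left (hRx y).1 (hρpos y).le
    · calc Rs ≤ ∫ y, ρ y * 2 := integral_mono hint_a (hint_ρ.mul_const _) fun y => by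
            show a y ≤ ρ y * 2
            rw [hact y]; exact mul_le_mul_of_nonneg_left (hRx y).2 (hρpos y).le
        _ = 2 := by rw [integral_mul_const, hρ1, one_mul]
  -- `∫ a` is a root of the profile's ratio equation
  have hβ : ∀ y, P.β y = a y / Rs := fun y => profileOf_β ha ha0 y
  have hroot : Rs * ratioSeries P σ Rs = 1 := by
    have hsumm := summable_ratioSeries (P := P) hσ hσ2 h.geomRatio_lt_one (R := Rs)
      (abs_le.2 ⟨by linarith [hRs_mem.1], hRs_mem.2⟩)
    have hterm : ∀ j, Rs * (coefLim P σ (fun _ => 1) j * Rs ^ j) =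
        clusterCoeff σ j * ∫ y, a y ^ (j + 1) := by
      intro j
      rw [coefLim]
      simp only [one_mul, hβ]
      have : ∫ y, (a y / Rs) ^ (j + 1) = (∫ y, a y ^ (j + 1)) / Rs ^ (j + 1) := by
        simp_rw [div_pow]
        rw [integral_div]
      rw [this]
      field_simp
      ring
    rw [ratioSeries, ← tsum_mul_left]
    simp_rw [hterm]
    rw [← integral_tsum_clusterCoeff hσ hσ2 ha ha0' hA hAσ]
    simp_rw [hpt]
    exact hρ1
  -- uniqueness of the root
  have hR : ratioLimit P σ = Rs := ratioLimit_eq_of_root h hRs_mem hroot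
  -- the series for `rhoLim` collapses
  rw [rhoLim]
  simp_rw [hR, hβ]
  rw [← hpt x]
  refine tsum_congr fun j => ?_
  rw [mul_assoc, ← mul_pow, mul_div_cancel₀ _ hRs_pos.ne']

end Identification

end LocalGibbsConcentration

end Summit.AtomisticToContinuum.HydrodynamicLimit.Theorems
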